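import Mathlib
import HarnessLib

/-!
# `NoHeavyLowerTail` (stmt-CriticalPhenomena-4575) — three-star hair words: designated stars and ports (for the U0' assembly, MWF-CERT §7.6 (e)/(f))

Support file (prover `prim-gen-swap` gen 9; `--supports stmt-CriticalPhenomena-4575`).  No definitions, no named facts, no sorries; Mathlib only.

A hair word `w : Fin m → Fin 3` designates star `x` to the port `p x` (`w x = 1`) or `p' x` (`w x = 2`); its port set is
`R_w = p(w⁻¹ 1) ∪ p'(w⁻¹ 2)` as in `StarSet.setCS_twoPortStarMultigraph_mixed_levelTwo`.  For the words of Step 2 (three designated stars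
`i, j, n` sent to three distinct ports):

* `StarSet.mem_ports_of_designated` — the designated port of a designated star lies in `R_w`;
* `StarSet.three_le_card_ports` — `3 ≤ |R_w|` (so the word is a budget word);
* `StarSet.designated_eq_triple`, `StarSet.card_designated_le_three` — `{x | w x ≠ 0} = {i, j, n}`, of card `≤ 3`;
* `StarSet.eq_third_of_designated` — a designated star other than `i, j` is `n` (injectivity of the charge ↦ word map given `(i, j)`).
-/

namespace Summit.CriticalPhenomena.PercolationContinuityZ3.Theorems

open Finset
open scoped BigOperators

namespace StarSet

variable {m n : ℕ}

/-- The designated port of a designated star is a port of the word. [folklore] -/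
theorem mem_ports_of_designated (p p' : Fin m → Fin n) (w : Fin m → Fin 3) (x : Fin m) (d : Fin n)
    (hx : (w x = 1 ∧ d = p x) ∨ (w x = 2 ∧ d = p' x)) :
    d ∈ (univ.filter fun y => w y = 1).image p ∪ (univ.filter fun y => w y = 2).image p' := by
  rcases hx with ⟨h1, rfl⟩ | ⟨h2, rfl⟩
  · exact mem_union_left _ (mem_image.2 ⟨x, mem_filter.2 ⟨mem_univ _, h1⟩, rfl⟩)
  · exact mem_union_right _ (mem_image.2 ⟨x, mem_filter.2 ⟨mem_univ _, h2⟩, rfl⟩)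

/-- **Three designated stars with three distinct ports give a budget word (`|R_w| ≥ 3`).** [MWF-CERT.md §5 Step 2] -/
theorem three_le_card_ports (p p' : Fin m → Fin n) (w : Fin m → Fin 3) (i j k : Fin m) (di dj dk : Fin n)
    (hi : (w i = 1 ∧ di = p i) ∨ (w i = 2 ∧ di = p' i)) (hj : (w j = 1 ∧ dj = p j) ∨ (w j = 2 ∧ dj = p' j))
    (hk : (w k = 1 ∧ dk = p k) ∨ (w k = 2 ∧ dk = p' k)) (hij : di ≠ dj) (hik : di ≠ dk) (hjk : dj ≠ dk) :
    3 ≤ ((univ.filter fun y => w y = 1).image p ∪ (univ.filter fun y => w y = 2).image p').card := by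
  have hsub : ({di, dj, dk} : Finset (Fin n)) ⊆ (univ.filter fun y => w y = 1).image p ∪ (univ.filter fun y => w y = 2).image p' := by
    intro d hd
    simp only [mem_insert, mem_singleton] at hd
    rcases hd with rfl | rfl | rfl
    · exact mem_ports_of_designated p p' w i _ hi
    · exact mem_ports_of_designated p p' w j _ hj
    · exact mem_ports_of_designated p p' w k _ hk
  have hcard : ({di, dj, dk} : Finset (Fin n)).card = 3 := by
    rw [card_insert_of_notMem, card_pair hjk]
    simp only [mem_insert, mem_singleton, not_or]; exact ⟨hij, hik⟩
  calc 3 = ({di, dj, dk} : Finset (Fin n)).card := hcard.symm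
    _ ≤ _ := card_le_card hsub

/-- The designated stars of a three-star word. [folklore] -/
theorem designated_eq_triple (w : Fin m → Fin 3) (i j k : Fin m) (hi : w i ≠ 0) (hj : w j ≠ 0) (hk : w k ≠ 0)
    (h0 : ∀ x, x ≠ i → x ≠ j → x ≠ k → w x = 0) :
    (univ.filter fun x => w x ≠ 0) = {i, j, k} := by
  ext x
  simp only [mem_filter, mem_univ, true_and, mem_insert, mem_singleton]
  constructor
  · intro hx
    by_contra h
    simp only [not_or] at h
    exact hx (h0 x h.1 h.2.1 h.2.2)
  · rintro (rfl | rfl | rfl) <;> assumption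

/-- A three-star word designates at most three stars. [folklore] -/
theorem card_designated_le_three (w : Fin m → Fin 3) (i j k : Fin m) (hi : w i ≠ 0) (hj : w j ≠ 0) (hk : w k ≠ 0)
    (h0 : ∀ x, x ≠ i → x ≠ j → x ≠ k → w x = 0) :
    (univ.filter fun x => w x ≠ 0).card ≤ 3 := by
  rw [designated_eq_triple w i j k hi hj hk h0]
  exact (card_insert_le _ _).trans (by
    have := card_insert_le j ({k} : Finset (Fin m))
    rw [card_singleton] at this
    omega)

/-- **Recovering the third star**: a designated star of a three-star word other than `i`, `j` is the third one. [folklore] -/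
theorem eq_third_of_designated (w : Fin m → Fin 3) (i j k : Fin m) (h0 : ∀ x, x ≠ i → x ≠ j → x ≠ k → w x = 0)
    (x : Fin m) (hx : w x ≠ 0) (hxi : x ≠ i) (hxj : x ≠ j) : x = k := by
  by_contra hxk
  exact hx (h0 x hxi hxj hxk)

end StarSet

end Summit.CriticalPhenomena.PercolationContinuityZ3.Theorems
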